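import Literature.NumberTheory.Automorphic.AdelicUnitaryGroupSpectrum
import Literature.NumberTheory.Automorphic.UnitaryGroupRestrictedProduct
import Literature.NumberTheory.Automorphic.UnitaryGroupArchSection
import Literature.NumberTheory.Automorphic.UnitaryGroupArchProjectionEmb
import Literature.NumberTheory.Automorphic.WeightForms
import Literature.AlgebraicGeometry.ShimuraVarieties.UnitaryBallAutomorphicForms
import Literature.AlgebraicGeometry.ShimuraVarieties.UnitaryBallCauchyRiemann
import HarnessLib

/-!
# Cohomological cotangent automorphic forms on a unitary group `U(J)(𝔸_F)` and the Hodge type of a discrete automorphic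
# representation — GENERIC Literature carriers (floor-0 programmes P2 / P3 / P4 of cell hodgecm-mathlib)

Topic `NumberTheory/Automorphic`; namespace `Literature.NumberTheory.Automorphic.UnitaryGroup.CotangentForms`.  DEFINITIONS WITH
BODIES + unfolding lemmas; no named fact, no instance, no notation, no `sorry`; imports = tree.

For the unitary group `U(J)` of a pair `(F, E, c)` and a matrix `J ∈ M_N(E)` — the tree's adelic group datum
`UnitaryGroup.adelicGroupData F E c N J` (★ `UnitaryGroupAutomorphicRep`; CM spelling `UnitaryGroup.cmDatum L N H`, `rfl`-equal,
★ `AdelicUnitaryGroupDatum`) with finite-adelic points `UnitaryGroup.finAdelic F E c N J` and `finAdelicToAdelic` (★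
`UnitaryGroupRestrictedProduct`) — an archimedean SECTION `ιinf : U(2,1) →* U(J)(𝔸_F)` at one indefinite place (the tree's ball-model
group `U21`; e.g. ★ `UnitaryGroup.archSectionU21CM L ι H T hT`) and a subgroup `Kc ≤ U(J)(𝔸_F)` (the compact archimedean factor away
from that place), this file types, as CONCRETE function spaces and predicates:

* §1 `rightRep`, `smoothFun`, `conjFun` — right translation of `U(J)(𝔸_{F,f})` on `ℂ²`-valued functions on `U(J)(𝔸_F)`, its smooth
  vectors, componentwise complex conjugation [BorelJacquet1979, §4.2];
* §2 `IsHolGerm ιinf Φ` / `holGerms ιinf` — «`Φ` has HOLOMORPHIC GERMS along `ιinf`»: at every base point `y` the probe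
  `b ↦ Φ (y · ιinf (expP b))` (★ `BallForms.expP`, the exponential chart of `𝔭 ≅ ℂ²` in `U(2,1)`) is real-differentiable at `0` with
  complex-linear differential (the Cauchy–Riemann condition along the ball directions, [Borel1997, §5.14]; [BorelWallach2000, VII 2.10]);
* §3 `holCotForms ιinf Kc` — the HOLOMORPHIC COTANGENT AUTOMORPHIC FORMS: left `U(J)(F)`-invariant `ℂ²`-valued functions of right
  `K_∞`-type the cotangent isotropy representation `weightOf x₀` of `Stab_{U(2,1)}(x₀) ≅ U(2) × U(1)` along `ιinf` (★ `weightForms`, ★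
  `BallForms.cotangentCocycle`), right `Kc`-invariant, smooth, with holomorphic germs; `cohForms ιinf Kc := holCotForms ⊔ conj holCotForms`
  — the `(1,0) ⊕ (0,1)` cohomological cotangent forms ([BorelWallach2000, VII 2.10/3.6]; for `U(2,1)` the contributions of
  `J⁺ = π^{1,0}`, `J⁻ = π^{0,1}`, [Rogawski1990, Prop. 15.2.1 (b)]);
* §4 the junction with the tree's honest `L²` spectrum (`AutomorphicSpectrum`: `AdelicGroupData.L2`, `rightRegular`,
  `DiscreteAutomorphicRep`): `toQuotFun` (a left-invariant function on `U(J)(𝔸_F)` read on the automorphic quotient, inverse of the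
  tree's `invQuot`), `DiscreteAutomorphicRep.ContainsForm Φ` (the `L²`-classes of the coordinates of `Φ` lie in `P`),
  `IsHolCotangentAt ιinf Kc` / `IsAntiholCotangentAt ιinf Kc` («`P` is H¹-COHOMOLOGICAL OF HODGE TYPE `(1,0)` resp. `(0,1)` at the
  place of `ιinf`»: `P` contains a non-zero holomorphic resp. antiholomorphic cotangent automorphic form), `finRep P` (the restriction
  of `P` to `U(J)(𝔸_{F,f})` along `finAdelicToAdelic`) and `HasFinComponent P σ` («the irreducible smooth `σ` OCCURS in `P|_{U(J)(𝔸_{F,f})}`»,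
  i.e. `σ ≅ P_f` for irreducible `P`, `σ`);
* §5 the CM ARCHIMEDEAN FACTOR OF A FRAME: for a CM field `L`, `H ∈ M₃(L)` and a frame `T ∈ GL₃(ℂ)` with `Tᴴ · ι(H) · T = diag(1,1,−1)`
  (signature `(2,1)` at the embedding `ι`), `cmArchSection L ι H T hT : U(2,1) →* U(H)(𝔸_{L⁺})` (★ `archSectionU21CM`, retyped on
  `(adelicGroupData L⁺ L c̄ 3 H).Adelic`) and `cmCompactFactor L ι H T hT` = the archimedean elements with trivial `ι`-component
  (`(ker ★ archProjU21EmbCM).map ★ archToAdelic ≅ ∏_{w ≠ w(ι)} U(H^{σ_w})`), compact when `H` is definite at the places `≠ w(ι)`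
  (`isCompact_cmCompactFactor`, from ★ `isCompact_ker_archProjU21EmbCM_of_posDef`) — the recipe of the crux's factor of record
  `archFactorOf F V` [BorelJacquet1979, §4.1]; [PlatonovRapinchuk1994, §3.2 Thm 3.1].

PROVENANCE / ONE CURRENCY.  §§1–3 are, token for token with the group generalised from `(K⁺, K, c̄, 3, Hm V)` to `(F, E, c, N, J)` and
the pair `(ιinf, Kc)` unbundled, the crux carriers ★ `Summits/HodgeConjecture/HodgeConjecture/Theorems/H413CohFormsCarriers.lean`
(`rightRep`, `smoothFun`, `conjFun`, `holCotForms 𝔞`, `cohForms 𝔞`, p787557) and `HodgeCM.Model.IsHolGerm` / `holGerms`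
(`Summits/HodgeConjecture/HodgeCM/Model/ThetaHolGerm.lean`), and §5 is the recipe of `archFactorOf F V` (`ιinf`, `Kc`) of the same crux
file, which Literature modules cannot import (CONVENTIONS §2: Literature never
imports `Summits.*`); those Summit-side declarations are INSTANCES of these by `rfl`, so the floor-0 engine letters
(`Rogawski1990/CohomologicalSpectrumInnerForm.lean`) and the Matsushima junction letter of the B4-archimedean desk, typed over THIS file,
fold into the crux sockets syntactically.  Nothing is asserted here.  HC_CM is proved only modulo the printed citations until rung 0 closes.

## References
* [BorelJacquet1979] A. Borel, H. Jacquet, *Automorphic forms and automorphic representations*, Corvallis PSPM 33.1 (1979), §4.1–4.2,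
  §4.6.
* [Borel1997] A. Borel, *Automorphic forms on SL₂(ℝ)*, Cambridge (1997), §5.14 (forms of a given `K`-type as functions on the group;
  holomorphy).
* [BorelWallach2000] A. Borel, N. Wallach, *Continuous cohomology, discrete subgroups, and representations of reductive groups*, 2nd
  ed. (2000), VII 2.10, 3.2, 3.6 (Hodge bigrading of `H^•(Γ\X)`, Matsushima).
* [Rogawski1990] J. Rogawski, *Automorphic representations of unitary groups in three variables*, Ann. of Math. Stud. 123 (1990),
  Prop. 15.2.1 (b) (held scan chunk p0244: `J_φ^±` carry `H¹`), §15.3.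
* [PlatonovRapinchuk1994] V. Platonov, A. Rapinchuk, *Algebraic groups and number theory* (1994), §3.2 Thm 3.1 (compactness of the real
  points of an anisotropic group), §5.1.
-/

noncomputable section

open NumberField MulAction MeasureTheory
open scoped ComplexConjugate ComplexOrder Matrix

namespace Literature.NumberTheory.Automorphic.UnitaryGroup.CotangentForms

open Literature.AlgebraicGeometry.ShimuraVarieties
open Literature.Geometry.ComplexHyperbolic.BallModel (U21 x₀)

/-! ## §1 Right translation by `U(J)(𝔸_{F,f})` on `ℂ²`-valued functions, smooth vectors, conjugation -/

section Generic

variable (F E : Type) [Field F] [NumberField F] [Field E] [NumberField E] [Algebra F E]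
  (c : E ≃ₐ[F] E) (N : ℕ) (J : Matrix (Fin N) (Fin N) E)

/-- **Right translation by the finite-adelic group** on `ℂ²`-valued functions on `U(J)(𝔸_F)`: `(R_g Φ)(x) = Φ (x · (1, g))` (★
`finAdelicToAdelic`).  Generic form of the crux carrier `…H413CohFormsCarriers.rightRep` (its instance at `(K⁺, K, c̄, 3, Hm V)`).
[cite: BorelJacquet1979, §4.2] -/
def rightRep : Representation ℂ (finAdelic F E c N J) ((adelicGroupData F E c N J).Adelic → (Fin 2 → ℂ)) where
  toFun g :=
    { toFun := fun Φ x => Φ (x * finAdelicToAdelic F E c N J g)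
      map_add' := fun _ _ => rfl
      map_smul' := fun _ _ => rfl }
  map_one' := by
    ext Φ x
    simp
  map_mul' g g' := by
    ext Φ x
    simp [mul_assoc]

/-- `rightRep g Φ x = Φ (x · (1, g))`. [cite: BorelJacquet1979, §4.2] -/
@[simp] theorem rightRep_apply (g : finAdelic F E c N J) (Φ : (adelicGroupData F E c N J).Adelic → (Fin 2 → ℂ))
    (x : (adelicGroupData F E c N J).Adelic) :
    rightRep F E c N J g Φ x = Φ (x * finAdelicToAdelic F E c N J g) := rfl

/-- **Smooth vectors** for the finite-adelic right translation: `ℂ²`-valued functions fixed by some OPEN subgroup of `U(J)(𝔸_{F,f})`.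
Generic form of `…H413CohFormsCarriers.smoothFun`. [cite: BorelJacquet1979, §4.2 (right `K`-finiteness)] -/
def smoothFun : Submodule ℂ ((adelicGroupData F E c N J).Adelic → (Fin 2 → ℂ)) :=
  ⨆ (Kf : Subgroup (finAdelic F E c N J)) (_ : IsOpen (Kf : Set (finAdelic F E c N J))),
    Representation.invariants ((rightRep F E c N J).comp Kf.subtype)

/-- **Componentwise complex conjugation** of `ℂ²`-valued functions on `U(J)(𝔸_F)`, a conjugate-linear map (it exchanges holomorphic and
antiholomorphic germs).  Generic form of `…H413CohFormsCarriers.conjFun`. [cite: BorelWallach2000, VII 2.10] -/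
def conjFun : ((adelicGroupData F E c N J).Adelic → (Fin 2 → ℂ)) →ₛₗ[starRingEnd ℂ]
    ((adelicGroupData F E c N J).Adelic → (Fin 2 → ℂ)) where
  toFun Φ := fun x => star (Φ x)
  map_add' Φ Φ' := by
    funext x
    simp [star_add]
  map_smul' r Φ := by
    funext x
    ext j
    simp

/-- `conjFun Φ x = star (Φ x)`. [cite: BorelWallach2000, VII 2.10] -/
@[simp] theorem conjFun_apply (Φ : (adelicGroupData F E c N J).Adelic → (Fin 2 → ℂ)) (x : (adelicGroupData F E c N J).Adelic) :
    conjFun F E c N J Φ x = star (Φ x) := rfl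

end Generic

/-! ## §2 Holomorphic germs along an archimedean section `ιinf : U(2,1) →* G` -/

section Germ

variable {GU : Type*} [Group GU] (ι : U21 →* GU)

/-- The archimedean PROBE of `Φ : G → ℂ²` at the base point `y` along `ι`: `b ↦ Φ (y · ι (expP b))`, `expP : ℂ² → U(2,1)` the
exponential of the `𝔭`-part (★ `BallForms.expP`).  Generic (any group `G`); = `HodgeCM.Model.germAt` of the crux model.
[cite: Borel1997, §5.14] -/
abbrev germAt (Φ : GU → (Fin 2 → ℂ)) (y : GU) : (Fin 2 → ℂ) → (Fin 2 → ℂ) :=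
  fun b => Φ (y * ι (BallForms.expP b))

/-- `germAt ι Φ y b = Φ (y · ι (expP b))`. [cite: Borel1997, §5.14] -/
theorem germAt_apply (Φ : GU → (Fin 2 → ℂ)) (y : GU) (b : Fin 2 → ℂ) :
    germAt ι Φ y b = Φ (y * ι (BallForms.expP b)) := rfl

/-- **`IsHolGerm ι Φ` — `Φ` has HOLOMORPHIC GERMS along `ι`**: at every base point `y` the probe `b ↦ Φ (y · ι (expP b))` is
real-differentiable at `0` with COMPLEX-LINEAR differential (Cauchy–Riemann along the ball directions `𝔭 ≅ ℂ²`).  Generic (any group);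
= `HodgeCM.Model.IsHolGerm` of the crux model. [cite: Borel1997, §5.14] [cite: BorelWallach2000, VII 2.10] -/
def IsHolGerm (Φ : GU → (Fin 2 → ℂ)) : Prop :=
  (∀ y : GU, DifferentiableAt ℝ (germAt ι Φ y) 0) ∧
    ∀ (y : GU) (v : Fin 2 → ℂ),
      fderiv ℝ (germAt ι Φ y) 0 (Complex.I • v) = Complex.I • fderiv ℝ (germAt ι Φ y) 0 v

variable {ι}

/-- `0` has holomorphic germs. [cite: Borel1997, §5.14] -/
theorem IsHolGerm.zero : IsHolGerm ι (0 : GU → (Fin 2 → ℂ)) := by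
  have h : ∀ y : GU, germAt ι (0 : GU → (Fin 2 → ℂ)) y = fun _ => 0 := fun _ => rfl
  refine ⟨fun y => ?_, fun y v => ?_⟩
  · rw [h]; exact differentiableAt_const _
  · rw [h]; simp

/-- Sums of functions with holomorphic germs have holomorphic germs. [cite: Borel1997, §5.14] -/
theorem IsHolGerm.add {Φ Ψ : GU → (Fin 2 → ℂ)} (hΦ : IsHolGerm ι Φ) (hΨ : IsHolGerm ι Ψ) : IsHolGerm ι (Φ + Ψ) := by
  have h : ∀ y : GU, germAt ι (Φ + Ψ) y = germAt ι Φ y + germAt ι Ψ y := fun _ => rfl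
  refine ⟨fun y => ?_, fun y v => ?_⟩
  · rw [h]; exact (hΦ.1 y).add (hΨ.1 y)
  · rw [h, fderiv_add (hΦ.1 y) (hΨ.1 y)]
    show fderiv ℝ (germAt ι Φ y) 0 (Complex.I • v) + fderiv ℝ (germAt ι Ψ y) 0 (Complex.I • v) =
      Complex.I • (fderiv ℝ (germAt ι Φ y) 0 v + fderiv ℝ (germAt ι Ψ y) 0 v)
    rw [hΦ.2 y v, hΨ.2 y v, smul_add]

/-- Scalar multiples of a function with holomorphic germs have holomorphic germs. [cite: Borel1997, §5.14] -/
theorem IsHolGerm.smul (r : ℂ) {Φ : GU → (Fin 2 → ℂ)} (hΦ : IsHolGerm ι Φ) : IsHolGerm ι (r • Φ) := by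
  have h : ∀ y : GU, germAt ι (r • Φ) y = r • germAt ι Φ y := fun _ => rfl
  refine ⟨fun y => ?_, fun y v => ?_⟩
  · rw [h]; exact (hΦ.1 y).const_smul r
  · rw [h, fderiv_const_smul (hΦ.1 y) r]
    show r • fderiv ℝ (germAt ι Φ y) 0 (Complex.I • v) = Complex.I • (r • fderiv ℝ (germAt ι Φ y) 0 v)
    rw [hΦ.2 y v, smul_comm]

variable (ι) in
/-- **`holGerms ι`** — the `ℂ`-submodule of `ℂ²`-valued functions on `G` with holomorphic germs along `ι`.  Generic; =
`HodgeCM.Model.holGerms` of the crux model. [cite: Borel1997, §5.14] -/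
def holGerms : Submodule ℂ (GU → (Fin 2 → ℂ)) where
  carrier := {Φ | IsHolGerm ι Φ}
  zero_mem' := IsHolGerm.zero
  add_mem' := IsHolGerm.add
  smul_mem' := IsHolGerm.smul

/-- Membership in `holGerms ι` is `IsHolGerm ι`. [cite: Borel1997, §5.14] -/
@[simp] theorem mem_holGerms {Φ : GU → (Fin 2 → ℂ)} : Φ ∈ holGerms ι ↔ IsHolGerm ι Φ := Iff.rfl

end Germ

/-! ## §3 Holomorphic and cohomological cotangent automorphic forms for an archimedean factor `(ιinf, Kc)` -/

section Forms

variable (F E : Type) [Field F] [NumberField F] [Field E] [NumberField E] [Algebra F E]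
  (c : E ≃ₐ[F] E) (N : ℕ) (J : Matrix (Fin N) (Fin N) E)
  (ιinf : U21 →* (adelicGroupData F E c N J).Adelic) (Kc : Subgroup (adelicGroupData F E c N J).Adelic)

/-- **`holCotForms ιinf Kc` — the HOLOMORPHIC COTANGENT AUTOMORPHIC FORMS of `U(J)` for the archimedean factor `(ιinf, Kc)`**
(`(1,0)`-forms of all finite levels on the ball quotients, read on the group): `ℂ²`-valued functions on `U(J)(𝔸_F)` that are (i)
LEFT-invariant under `U(J)(F)` (★ `AdelicGroupData.toAdelic`) and of RIGHT `K_∞`-type the cotangent isotropy representation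
`weightOf x₀` of `Stab_{U(2,1)}(x₀) ≅ U(2) × U(1)` along `ιinf` (★ `weightForms`, [Borel1997, §5.14]; ★ `BallForms.cotangentCocycle`),
(ii) right-invariant under `Kc`, (iii) smooth under `U(J)(𝔸_{F,f})`, (iv) with holomorphic germs along `ιinf`.  Generic form of the crux
carrier `…H413CohFormsCarriers.holCotForms 𝔞` (instance at `(K⁺, K, c̄, 3, Hm V, 𝔞.ιinf, 𝔞.Kc)`).
[cite: Borel1997, §5.14] [cite: BorelWallach2000, VII 2.10 and 3.6] [cite: BorelJacquet1979, §4.2] -/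
def holCotForms : Submodule ℂ ((adelicGroupData F E c N J).Adelic → (Fin 2 → ℂ)) :=
  Literature.NumberTheory.Automorphic.weightForms (adelicGroupData F E c N J).toAdelic.range
      (ιinf.comp (stabilizer (↥U21) x₀).subtype) (BallForms.isPullbackCocycle_cotangentCocycle.weightOf x₀) ⊓
    { carrier := {Φ | ∀ k ∈ Kc, ∀ x, Φ (x * k) = Φ x}
      add_mem' := fun hΦ hΨ k hk x => by simp only [Pi.add_apply, hΦ k hk x, hΨ k hk x]
      zero_mem' := fun _ _ _ => rfl
      smul_mem' := fun r Φ hΦ k hk x => by simp only [Pi.smul_apply, hΦ k hk x] } ⊓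
    smoothFun F E c N J ⊓ holGerms ιinf

/-- **`cohForms ιinf Kc` — the `(1,0) ⊕ (0,1)` COHOMOLOGICAL COTANGENT AUTOMORPHIC FORMS**: holomorphic cotangent forms and their
complex conjugates (the two Hodge types of degree `1` on the ball quotients).  Generic form of `…H413CohFormsCarriers.cohForms 𝔞`.
[cite: BorelWallach2000, VII 2.10 and 3.6] [cite: Rogawski1990, Prop. 15.2.1 (b)] -/
def cohForms : Submodule ℂ ((adelicGroupData F E c N J).Adelic → (Fin 2 → ℂ)) :=
  holCotForms F E c N J ιinf Kc ⊔ (holCotForms F E c N J ιinf Kc).map (conjFun F E c N J)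

variable {F E c N J ιinf Kc}

/-- Unfolding of `holCotForms`: the four conjuncts. [cite: Borel1997, §5.14] -/
theorem mem_holCotForms_iff {Φ : (adelicGroupData F E c N J).Adelic → (Fin 2 → ℂ)} :
    Φ ∈ holCotForms F E c N J ιinf Kc ↔
      Φ ∈ Literature.NumberTheory.Automorphic.weightForms (adelicGroupData F E c N J).toAdelic.range
          (ιinf.comp (stabilizer (↥U21) x₀).subtype) (BallForms.isPullbackCocycle_cotangentCocycle.weightOf x₀) ∧
        (∀ k ∈ Kc, ∀ x, Φ (x * k) = Φ x) ∧ Φ ∈ smoothFun F E c N J ∧ IsHolGerm ιinf Φ := by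
  simp only [holCotForms, Submodule.mem_inf, Submodule.mem_mk, AddSubmonoid.mem_mk, AddSubsemigroup.mem_mk,
    Set.mem_setOf_eq, mem_holGerms, and_assoc]

/-- Holomorphic cotangent forms are cohomological cotangent forms. [cite: BorelWallach2000, VII 2.10] -/
theorem holCotForms_le_cohForms : holCotForms F E c N J ιinf Kc ≤ cohForms F E c N J ιinf Kc :=
  le_sup_left

end Forms

/-! ## §4 The junction with the honest `L²` spectrum: Hodge type and finite component of a discrete automorphic representation -/

section Spectrum

variable {K : Type} [Field K] [NumberField K] (𝒢 : AdelicGroupData.{0} K)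

/-- **A left-invariant function read on the automorphic quotient**: `x = g · (A_G G(K)) ↦ Φ(g⁻¹)` — the inverse of the tree's dictionary
`invQuot` (`AutomorphicForms`: a function `f` on `G(𝔸_K) ⧸ (A_G G(K))` gives the left-`A_G G(K)`-invariant `g ↦ f [g⁻¹]`).  Defined
through a choice of coset representative (`Quotient.out`); for `Φ` left-invariant under `A_G · G(K)` the value does not depend on the
choice (`toQuotFun_mk`).  [cite: BorelJacquet1979, §4.2 (left `G(K)`-invariance) and §4.6] -/
def toQuotFun (Φ : 𝒢.Adelic → ℂ) : 𝒢.automorphicQuotient → ℂ :=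
  fun x => Φ ((Quotient.out (x : 𝒢.Adelic ⧸ 𝒢.quotientSubgroup)) : 𝒢.Adelic)⁻¹

variable {𝒢} in
/-- For `Φ` left-invariant under `A_G · G(K)`, `toQuotFun Φ [g] = Φ (g⁻¹)`. [cite: BorelJacquet1979, §4.2] -/
theorem toQuotFun_mk {Φ : 𝒢.Adelic → ℂ} (hΦ : ∀ γ ∈ 𝒢.quotientSubgroup, ∀ g, Φ (γ * g) = Φ g) (g : 𝒢.Adelic) :
    toQuotFun 𝒢 Φ (𝒢.toAutomorphicQuotient g) = Φ g⁻¹ := by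
  obtain ⟨h, hh⟩ := QuotientGroup.mk_out_eq_mul 𝒢.quotientSubgroup g
  show Φ ((Quotient.out (QuotientGroup.mk g : 𝒢.Adelic ⧸ 𝒢.quotientSubgroup)) : 𝒢.Adelic)⁻¹ = Φ g⁻¹
  rw [hh, mul_inv_rev]
  exact hΦ _ (inv_mem h.2) _

variable {𝒢}
variable {μ : Measure 𝒢.automorphicQuotient} [SMulInvariantMeasure 𝒢.Adelic 𝒢.automorphicQuotient μ]

/-- **`P.ContainsForm Φ`** — the `L²`-classes of the two coordinate functions of the `ℂ²`-valued form `Φ` (read on the automorphic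
quotient through `toQuotFun`) are square-integrable and LIE IN the discrete automorphic representation `P ⊂ L²(G(𝔸) ⧸ A_G G(K), μ)`
(Mathlib `MemLp.toLp`).  [cite: BorelJacquet1979, §4.6] [cite: BorelWallach2000, VII 3.2] -/
def _root_.Literature.NumberTheory.Automorphic.DiscreteAutomorphicRep.ContainsForm (P : DiscreteAutomorphicRep 𝒢 μ)
    (Φ : 𝒢.Adelic → (Fin 2 → ℂ)) : Prop :=
  ∀ j : Fin 2, ∃ h : MemLp (toQuotFun 𝒢 fun g => Φ g j) 2 μ,
    MemLp.toLp (toQuotFun 𝒢 fun g => Φ g j) h ∈ P.space.toSubmodule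

end Spectrum

section HodgeType

variable {F E : Type} [Field F] [NumberField F] [Field E] [NumberField E] [Algebra F E]
  {c : E ≃ₐ[F] E} {N : ℕ} {J : Matrix (Fin N) (Fin N) E}
  {μ : Measure (adelicGroupData F E c N J).automorphicQuotient}
  [SMulInvariantMeasure (adelicGroupData F E c N J).Adelic (adelicGroupData F E c N J).automorphicQuotient μ]

/-- **`P.IsHolCotangentAt ιinf Kc` — `P` is H¹-COHOMOLOGICAL OF HODGE TYPE `(1,0)` at the place of `ιinf`** (relative to the compact
factor `Kc`): the discrete automorphic representation `P` of `U(J)` contains (the `L²`-classes of the coordinates of) a NON-ZERO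
holomorphic cotangent automorphic form `Φ ∈ holCotForms ιinf Kc`.  For `U(2,1)`: `P_∞` is the non-tempered cohomological `J⁺ = π^{1,0}`
at that place and trivial on `Kc` ([Rogawski1990, Prop. 15.2.1 (b)]; [BorelWallach2000, VII 3.2/3.6]: the `(1,0)`-summands of Matsushima's
formula). [cite: Rogawski1990, Prop. 15.2.1 (b) and §15.3] [cite: BorelWallach2000, VII 3.2 and 3.6] -/
def _root_.Literature.NumberTheory.Automorphic.DiscreteAutomorphicRep.IsHolCotangentAt
    (P : DiscreteAutomorphicRep (adelicGroupData F E c N J) μ)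
    (ιinf : U21 →* (adelicGroupData F E c N J).Adelic) (Kc : Subgroup (adelicGroupData F E c N J).Adelic) : Prop :=
  ∃ Φ ∈ holCotForms F E c N J ιinf Kc, Φ ≠ 0 ∧ P.ContainsForm Φ

/-- **`P.IsAntiholCotangentAt ιinf Kc` — `P` is H¹-COHOMOLOGICAL OF HODGE TYPE `(0,1)` at the place of `ιinf`**: `P` contains a non-zero
ANTIHOLOMORPHIC cotangent automorphic form, i.e. a member of the `conjFun`-image of `holCotForms ιinf Kc` (`P_∞ = J⁻ = π^{0,1}` at that place).
[cite: Rogawski1990, Prop. 15.2.1 (b) and §15.3] [cite: BorelWallach2000, VII 2.10, 3.2 and 3.6] -/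
def _root_.Literature.NumberTheory.Automorphic.DiscreteAutomorphicRep.IsAntiholCotangentAt
    (P : DiscreteAutomorphicRep (adelicGroupData F E c N J) μ)
    (ιinf : U21 →* (adelicGroupData F E c N J).Adelic) (Kc : Subgroup (adelicGroupData F E c N J).Adelic) : Prop :=
  ∃ Φ ∈ (holCotForms F E c N J ιinf Kc).map (conjFun F E c N J), Φ ≠ 0 ∧ P.ContainsForm Φ

/-- **`P.finRep` — the restriction of `P` to the finite-adelic group `U(J)(𝔸_{F,f})`** along ★ `finAdelicToAdelic` (the algebraic
representation underlying the closed subrepresentation `P.space` of the regular representation). [cite: BorelJacquet1979, §4.6] -/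
def _root_.Literature.NumberTheory.Automorphic.DiscreteAutomorphicRep.finRep
    (P : DiscreteAutomorphicRep (adelicGroupData F E c N J) μ) :
    Representation ℂ (finAdelic F E c N J) P.space.toSubmodule :=
  P.space.toContRep.toRepresentation.comp (finAdelicToAdelic F E c N J)

/-- **`P.HasFinComponent σ` — the representation `σ` of `U(J)(𝔸_{F,f})` OCCURS in `P|_{U(J)(𝔸_{F,f})}`**: there is an INJECTIVE
`U(J)(𝔸_{F,f})`-equivariant linear map `σ → P` (Mathlib `Representation.IntertwiningMap`).  For `P` and `σ` irreducible (`σ` smooth)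
this says `σ ≅ P_f`, the finite component of `P ≅ P_∞ ⊗ P_f` ([BorelJacquet1979, §4.6]; Flath). [cite: BorelJacquet1979, §4.6] -/
def _root_.Literature.NumberTheory.Automorphic.DiscreteAutomorphicRep.HasFinComponent
    (P : DiscreteAutomorphicRep (adelicGroupData F E c N J) μ)
    {W : Type} [AddCommGroup W] [Module ℂ W] (σ : Representation ℂ (finAdelic F E c N J) W) : Prop :=
  ∃ f : σ.IntertwiningMap P.finRep, Function.Injective f

end HodgeType

/-! ## §5 The CM archimedean factor of a frame: `(ιinf, Kc)` for `U(H)`, `H ∈ M₃(L)` of signature `(2,1)` at `ι` -/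

section CMFactor

variable (L : Type) [Field L] [NumberField L] [IsCMField L] (ι : L →+* ℂ) (H : Matrix (Fin 3) (Fin 3) L) (T : GL (Fin 3) ℂ)
  (hT : (T : Matrix (Fin 3) (Fin 3) ℂ)ᴴ * H.map ι * (T : Matrix (Fin 3) (Fin 3) ℂ) = Literature.Geometry.ComplexHyperbolic.BallModel.J)

/-- **`cmArchSection L ι H T hT : U(2,1) →* U(H)(𝔸_{L⁺})`** — the CM archimedean SECTION at the embedding `ι` through the frame `T`
(`Tᴴ ι(H) T = diag(1,1,−1)`): ★ `UnitaryGroup.archSectionU21CM`, retyped on `(adelicGroupData L⁺ L c̄ 3 H).Adelic` (the same type by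
`rfl`, ★ `AdelicUnitaryGroupDatum`).  `= (archFactorOf F V).ιinf` of the crux at HodgeCM's Sylvester frame (`rfl`). [cite: BorelJacquet1979, §4.1] -/
def cmArchSection : U21 →* (adelicGroupData (↥(maximalRealSubfield L)) L (IsCMField.complexConj L) 3 H).Adelic :=
  archSectionU21CM L ι H T hT

/-- `cmArchSection` is `archSectionU21CM` (`rfl`). [cite: BorelJacquet1979, §4.1] -/
theorem cmArchSection_eq : cmArchSection L ι H T hT = archSectionU21CM L ι H T hT := rfl

/-- `cmArchSection` is injective (★ `archSectionU21CM_injective`). [cite: BorelJacquet1979, §4.1] -/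
theorem cmArchSection_injective : Function.Injective (cmArchSection L ι H T hT) :=
  archSectionU21CM_injective L ι H T hT

/-- **`cmCompactFactor L ι H T hT ≤ U(H)(𝔸_{L⁺})`** — the COMPACT ARCHIMEDEAN FACTOR away from `ι`: the image under ★ `archToAdelic`
(`g ↦ (g, 1)`) of the kernel of the archimedean projection ★ `archProjU21EmbCM` at `ι` (`U(H)(L⁺ ⊗ ℝ) →* U(2,1)`), i.e. the archimedean
elements with trivial `ι`-component, `≅ ∏_{w ≠ w(ι)} U(H^{σ_w})`.  `= (archFactorOf F V).Kc` of the crux (`rfl`).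
[cite: BorelJacquet1979, §4.1] [cite: PlatonovRapinchuk1994, §5.1] -/
def cmCompactFactor : Subgroup (adelicGroupData (↥(maximalRealSubfield L)) L (IsCMField.complexConj L) 3 H).Adelic :=
  (archProjU21EmbCM L H ι T (formCongr_eq_of_conjTranspose L ι H T hT)).ker.map
    (archToAdelic (↥(maximalRealSubfield L)) L (IsCMField.complexConj L) 3 H)

/-- Unfolding of `cmCompactFactor` (`rfl`). [cite: BorelJacquet1979, §4.1] -/
theorem cmCompactFactor_eq : cmCompactFactor L ι H T hT =
    (archProjU21EmbCM L H ι T (formCongr_eq_of_conjTranspose L ι H T hT)).ker.map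
      (archToAdelic (↥(maximalRealSubfield L)) L (IsCMField.complexConj L) 3 H) := rfl

/-- **`cmCompactFactor` is compact when `H` is positive definite at every complex place `≠ w(ι)`** (signature `(2,1)` at `ι`, `(3,0)`
elsewhere: the kernel of the projection at `ι` is `∏_{w ≠ w(ι)} U(3)`, ★ `isCompact_ker_archProjU21EmbCM_of_posDef`, and ★ `archToAdelic`
is continuous). [cite: PlatonovRapinchuk1994, §3.2 Thm 3.1] -/
theorem isCompact_cmCompactFactor
    (hdef : ∀ τ' : L →+* ℂ, InfinitePlace.mk τ' ≠ InfinitePlace.mk ι → (H.map τ').PosDef) :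
    IsCompact (cmCompactFactor L ι H T hT :
      Set (adelicGroupData (↥(maximalRealSubfield L)) L (IsCMField.complexConj L) 3 H).Adelic) := by
  rw [cmCompactFactor, Subgroup.coe_map]
  exact (isCompact_ker_archProjU21EmbCM_of_posDef L H ι T (formCongr_eq_of_conjTranspose L ι H T hT) hdef).image
    (continuous_archToAdelic (↥(maximalRealSubfield L)) L (IsCMField.complexConj L) 3 H)

end CMFactor

end Literature.NumberTheory.Automorphic.UnitaryGroup.CotangentForms

end
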